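import Summits.QuantumFields.BalabanUV.Beta.GAN24.RespInnerBondKernel
import Summits.QuantumFields.BalabanUV.Beta.GAN24.VHSlotProfile
import Summits.QuantumFields.BalabanUV.Beta.GAN24.VHWordsZeroVhSAt

/-!
# `BalabanUV.Beta.GAN24.RespChargeSym` — binder row G-an2-4 ∕ (CONV-C), W-slot CT-W, conservation law (C)∕(C)sym, step (L3c)(vii) of this lineage's note
# `HOME/b2b-balaban-gan24-formalise-leaf-04/g66/CSYM-LEVEL0-KERNEL-BLUEPRINT.md` §8: **THE `(μ ↔ ν)`-SYMMETRISED COLUMN CHARGES OF THE GAUGE-DIFFERENTIATED INVERSE ARE A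
# COMBINATION OF THE DRESSED KERNEL'S OWN COLUMN CHARGES** — `chg^{𝒦_μ}_ν(g, t) + chg^{𝒦_ν}_μ(g, t) = −c₀σ · Σ_{ρ′} chg_{ρ′}(g, t) · V_{ρ′}` at level 0, where
# `chg^{𝒦_μ}_ν(g,t) = −Σ'_{s′}Σ_b (X̃∘𝒮_μ)(t,s′)(g,b)·chg_ν(b,s′)` (37 `hasSum_respKernel_col`), `chg_{ρ′}` is the exit-face column charge of `X̃♮_0` (4 `hasSum_dressedStep_col`) and
# `V_{ρ′} = (𝒥′_{μν} + 𝒥′_{νμ})(0, inr ρ′)` is the block constant of the multiplier-leg source — the FIELD-LEG source cancels by 35 `tsum_faceface_S0_add_swap`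

NOT IN PRINT; OUR BOOKKEEPING ([folklore] tsum bookkeeping over TREE objects BY NAME: this lineage's 35 `RespGaugeStencil.tsum_faceface_S0_add_swap ∕ tsum_faceface_block_periodic ∕
decays_faceStencil ∕ SpureRecAt_zero_unitS_inl_inl`, 37 `RespInnerBondKernel.decays_gaugeStencil`, 25 `VHSlotProfile.tsum_col_mul_profile`, 28 `VHWordsZeroVhSAt.vhS_inr_fst_eq_zero`, 4
`DressedStepFaceCharges.hasSum_dressedStep_col`; G-an2-4 formalisation swarm, leaf prover `b2b-balaban-gan24-formalise-leaf-04`, gen 67).  HONEST FRAMING (cell contract, verbatim):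
«discharging `BetaPertH` makes Bałaban's UV stability UNCONDITIONAL — a real constructive-QFT result; it is NOT the continuum limit and NOT the Clay problem.»  HONEST DEPENDENCY (verbatim):
«continuum YM on T⁴ ⇐ BetaPertH ∧ nine spine estimates (0/9 proved); BetaPertH ⇐ (D1) ∧ (D4) ∧ CAP+tail; G-an2-4 gates asym, D1 and NE2/3/4.»

WHY (blueprint §9; journal [LEAF04-G67-INTENT35]).  (§1) the `b`-sum against the dressed charge keeps `b = inl ν` at the exit face; one Fubini turns `(X̃∘𝒮_μ)·h^{(ν)}` into
`X̃·(𝒮_μ h^{(ν)})`: `chg^{𝒦_μ}_ν(g,t) = −c₀σ·Σ'_s Σ_f X̃(t,s)(g,f)·𝒥′_{μν}(s,f)`; (§2) at level 0 `𝒥′_{μν} + 𝒥′_{νμ}` vanishes on field legs (35), is block-periodic, and vanishes on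
multiplier legs off the coarse lattice; (§3) so the symmetrised charge sees only block-constant multiplier-leg sources against the coarsely supported `inr` columns of `X̃` (25).

WHAT ([folklore]; generic `d`; in-block root, `1 ≤ Lc`; 0 `def`, 0 cited facts, 0 `def … : Prop`, 0 sorry): §1 (every `j`, `S` `LocStencil`): `sum_mul_faceCharge`, `summable_faceSource`,
`abs_faceSource_le`, **`tsum_comp_faceCharge_eq`** (the Fubini), **`respCharge_eq`**; §2 (level 0, `S♮_0`): `faceSource_S0_add_swap_inl`, `faceSource_S0_block_periodic`, `SpureRecAt_zero_unitS_inr_fst_off`,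
`faceSource_S0_inr_off`; §3 **`respCharge_add_swap_eq`** (the headline).  Asserts NO value of Bałaban's tables beyond an3's ∕ an1's DEFINED ones; discharges NOTHING of (C)sym ∕ (Q-D) ∕
(Q-D-rate) ∕ «T2Shape» ∕ «T2Drift» ∕ (hW, hWall); NEVER «G-an2-4 closed» as (CONV-C); NOT D1, NOT `BetaPertH`, NOT continuum, NOT Clay.  2026-08-23; no existing file touched.
-/

noncomputable section

open Finset
open scoped BigOperators
open Literature.MathematicalPhysics.QuantumFieldTheory
open Literature.MathematicalPhysics.QuantumFieldTheory.Balaban1983to89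
open Literature.MathematicalPhysics.QuantumFieldTheory.Balaban1983to89.Beta
open AffineAveraging (Site box toSite)
open AveragingContours (off)
open B12Sec2to5 (l1 l1_nonneg)
open ExpKernelCalculus (MKer comp Decays BiLoc Zl Zl_nonneg shiftK summable_exp_shift summable_exp_shift' tsum_exp_shift)
open OneStepResolventKernel (Fib LocStencil decays_mono)
open OneStepKernelFamily (KInvStep decays_KInvStep)
open StepJetData (wilsonA)
open Summit.QuantumFields.BalabanUV.Beta.HessKerDressedUnits (unitK unitS unitS_apply decays_unitK)
open Summit.QuantumFields.BalabanUV.Beta.AxialDressingRooted (coDressKBmAt decays_coDressKBmAt)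
open Summit.QuantumFields.BalabanUV.Beta.SpineRooted (SpureRecAt SpureRecAt_zero_level)
open Summit.QuantumFields.BalabanUV.Beta.GAN24.DressedStepFaceCharges (hasSum_dressedStep_col)
open Summit.QuantumFields.BalabanUV.Beta.GAN24.VHSlotProfile (tsum_col_mul_profile)
open Summit.QuantumFields.BalabanUV.Beta.GAN24.VHWordsZeroVhSAt (vhS_inr_fst_eq_zero)
open Summit.QuantumFields.BalabanUV.Beta.GAN24.RespGaugeStencil (decays_faceStencil tsum_faceface_S0_add_swap tsum_faceface_block_periodic)

namespace Summit.QuantumFields.BalabanUV.Beta.GAN24.RespChargeSym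

variable {d : ℕ} {Lc : ℕ} [NeZero Lc] {r : Fin (d + 1) → ℕ} {S : Fin (d + 1) → Site (d + 1) → MKer (d + 1) (Fib d)} {Cs δs : ℝ}

/-! ## §1 The column charge of `𝒦_μ` as `X̃` applied to the face source `𝒥′_{μν}` -/

section Generic

omit [NeZero Lc] in
/-- [folklore] **THE FIBRE SUM AGAINST THE DRESSED COLUMN CHARGE KEEPS THE EXIT-FACE FIELD LEG**: `Σ_b A(b)·chg_ν(b, s′) = A(inl ν)·[s′_ν % Lc = Lc−1]·c₀·σ`. -/
theorem sum_mul_faceCharge (A : Fib d → ℝ) (ν : Fin (d + 1)) (s' : Site (d + 1)) (c₀ σ : ℝ) :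
    ∑ b : Fib d, A b * Sum.elim (fun a : Fin (d + 1) => if s' a % (Lc : ℤ) = (Lc : ℤ) - 1 then c₀ * (if a = ν then σ else 0) else 0) (fun _ => (0 : ℝ)) b =
      A (Sum.inl ν) * (if s' ν % (Lc : ℤ) = (Lc : ℤ) - 1 then c₀ * σ else 0) := by
  rw [Fintype.sum_sum_type]
  have hr : ∑ m : Fin (d + 1), A (Sum.inr m) * Sum.elim (fun a : Fin (d + 1) => if s' a % (Lc : ℤ) = (Lc : ℤ) - 1 then c₀ * (if a = ν then σ else 0) else 0)
      (fun _ => (0 : ℝ)) (Sum.inr m : Fib d) = 0 := Finset.sum_eq_zero fun m _ => by simp only [Sum.elim_inr, mul_zero]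
  rw [hr, add_zero]
  simp only [Sum.elim_inl]
  rw [Finset.sum_eq_single ν]
  · simp only [if_true]
  · intro a _ ha
    rw [if_neg ha, mul_zero]
    split_ifs <;> simp
  · intro h
    exact absurd (Finset.mem_univ ν) h

variable (Lc) in
omit [NeZero Lc] in
/-- [folklore] The face source `s′ ↦ [s′_ν]·T s s′ f (inl ν)` of a decaying kernel `T` is summable. -/
theorem summable_faceSource {T : MKer (d + 1) (Fib d)} {CT mT : ℝ} (hT : Decays T CT mT) (hmT : 0 < mT) (ν : Fin (d + 1)) (s : Site (d + 1)) (f : Fib d) :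
    Summable fun s' : Site (d + 1) => (if s' ν % (Lc : ℤ) = (Lc : ℤ) - 1 then T s s' f (Sum.inl ν) else 0) := by
  have hCT : 0 ≤ CT := hT.nonneg (Sum.inl 0)
  refine Summable.of_norm_bounded ((summable_exp_shift hmT s).mul_left CT) (fun s' => ?_)
  rw [Real.norm_eq_abs]
  split_ifs
  · exact hT s s' f (Sum.inl ν)
  · rw [abs_zero]; exact (abs_nonneg _).trans (hT s s' f (Sum.inl ν))

variable (Lc) in
omit [NeZero Lc] in
/-- [folklore] … and bounded by `CT·Zl(mT)` uniformly in `s`. -/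
theorem abs_faceSource_le {T : MKer (d + 1) (Fib d)} {CT mT : ℝ} (hT : Decays T CT mT) (hmT : 0 < mT) (ν : Fin (d + 1)) (s : Site (d + 1)) (f : Fib d) :
    |∑' s' : Site (d + 1), (if s' ν % (Lc : ℤ) = (Lc : ℤ) - 1 then T s s' f (Sum.inl ν) else 0)| ≤ CT * Zl (d + 1) mT := by
  have hCT : 0 ≤ CT := hT.nonneg (Sum.inl 0)
  have hs := (summable_exp_shift hmT s).mul_left CT
  have hb := tsum_of_norm_bounded hs.hasSum (f := fun s' : Site (d + 1) => if s' ν % (Lc : ℤ) = (Lc : ℤ) - 1 then T s s' f (Sum.inl ν) else 0) (fun s' => ?_)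
  · rw [Real.norm_eq_abs] at hb
    refine hb.trans (le_of_eq ?_)
    rw [tsum_mul_left, tsum_exp_shift]
  · rw [Real.norm_eq_abs]
    split_ifs
    · exact hT s s' f (Sum.inl ν)
    · rw [abs_zero]; exact (abs_nonneg _).trans (hT s s' f (Sum.inl ν))

omit [NeZero Lc] in
/-- [folklore] **ONE FUBINI: `(X ∘ T)·h = X·(T h)` ON THE EXIT-FACE FIELD** (any decaying `X`, `T`; every row `(t, g)`):
`Σ'_{s′} [s′_ν]·(X ∘ T)(t, s′)(g, inl ν) = Σ'_s Σ_f X(t,s)(g,f) · Σ'_{s′} [s′_ν]·T(s, s′)(f, inl ν)`. -/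
theorem tsum_comp_faceCharge_eq {X T : MKer (d + 1) (Fib d)} {CX mX CT mT : ℝ} (hX : Decays X CX mX) (hmX : 0 < mX) (hT : Decays T CT mT) (hmT : 0 < mT)
    (ν : Fin (d + 1)) (t : Site (d + 1)) (g : Fib d) :
    (∑' s' : Site (d + 1), (if s' ν % (Lc : ℤ) = (Lc : ℤ) - 1 then comp X T t s' g (Sum.inl ν) else 0)) =
      ∑' s : Site (d + 1), ∑ f : Fib d, X t s g f * ∑' s' : Site (d + 1), (if s' ν % (Lc : ℤ) = (Lc : ℤ) - 1 then T s s' f (Sum.inl ν) else 0) := by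
  classical
  have hCX : 0 ≤ CX := hX.nonneg (Sum.inl 0)
  have hCT : 0 ≤ CT := hT.nonneg (Sum.inl 0)
  -- the double family `(s, s′) ↦ Σ_f X t s g f · [s′_ν]·T s s′ f (inl ν)` with a product-in-`s′`-shift majorant
  have hin : ∀ s : Site (d + 1), HasSum (fun s' : Site (d + 1) => ((Fintype.card (Fib d) : ℝ) * (CX * CT) * Real.exp (-mX * l1 (t - s))) * Real.exp (-mT * l1 (s - s')))
      (((Fintype.card (Fib d) : ℝ) * (CX * CT) * Real.exp (-mX * l1 (t - s))) * Zl (d + 1) mT) := by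
    intro s
    have h := (summable_exp_shift hmT s).hasSum
    rw [tsum_exp_shift s] at h
    exact h.mul_left _
  have hM0 : Summable fun q : Site (d + 1) × Site (d + 1) => ((Fintype.card (Fib d) : ℝ) * (CX * CT) * Real.exp (-mX * l1 (t - q.1))) * Real.exp (-mT * l1 (q.1 - q.2)) := by
    refine (summable_prod_of_nonneg fun q => by positivity).2 ⟨fun s => (hin s).summable, ?_⟩
    exact (((summable_exp_shift hmX t).mul_left ((Fintype.card (Fib d) : ℝ) * (CX * CT))).mul_right (Zl (d + 1) mT)).congr fun s => ((hin s).tsum_eq).symm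
  have hGle : ∀ q : Site (d + 1) × Site (d + 1), |∑ f : Fib d, X t q.1 g f * (if q.2 ν % (Lc : ℤ) = (Lc : ℤ) - 1 then T q.1 q.2 f (Sum.inl ν) else 0)| ≤
      ((Fintype.card (Fib d) : ℝ) * (CX * CT) * Real.exp (-mX * l1 (t - q.1))) * Real.exp (-mT * l1 (q.1 - q.2)) := by
    intro q
    refine (Finset.abs_sum_le_sum_abs _ _).trans ?_
    have hterm : ∀ f : Fib d, |X t q.1 g f * (if q.2 ν % (Lc : ℤ) = (Lc : ℤ) - 1 then T q.1 q.2 f (Sum.inl ν) else 0)| ≤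
        (CX * CT) * Real.exp (-mX * l1 (t - q.1)) * Real.exp (-mT * l1 (q.1 - q.2)) := by
      intro f
      rw [abs_mul]
      have h2 : |(if q.2 ν % (Lc : ℤ) = (Lc : ℤ) - 1 then T q.1 q.2 f (Sum.inl ν) else 0)| ≤ CT * Real.exp (-mT * l1 (q.1 - q.2)) := by
        split_ifs
        · exact hT q.1 q.2 f (Sum.inl ν)
        · rw [abs_zero]; exact (abs_nonneg _).trans (hT q.1 q.2 f (Sum.inl ν))
      calc |X t q.1 g f| * |(if q.2 ν % (Lc : ℤ) = (Lc : ℤ) - 1 then T q.1 q.2 f (Sum.inl ν) else 0)|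
          ≤ (CX * Real.exp (-mX * l1 (t - q.1))) * (CT * Real.exp (-mT * l1 (q.1 - q.2))) := mul_le_mul (hX t q.1 g f) h2 (abs_nonneg _) (by positivity)
        _ = _ := by ring
    refine (Finset.sum_le_sum fun f _ => hterm f).trans (le_of_eq ?_)
    rw [Finset.sum_const, Finset.card_univ, nsmul_eq_mul]
    ring
  have hG : Summable fun q : Site (d + 1) × Site (d + 1) => ∑ f : Fib d, X t q.1 g f * (if q.2 ν % (Lc : ℤ) = (Lc : ℤ) - 1 then T q.1 q.2 f (Sum.inl ν) else 0) :=
    Summable.of_norm_bounded hM0 (fun q => by rw [Real.norm_eq_abs]; exact hGle q)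
  have hG' : Summable fun q : Site (d + 1) × Site (d + 1) => ∑ f : Fib d, X t q.2 g f * (if q.1 ν % (Lc : ℤ) = (Lc : ℤ) - 1 then T q.2 q.1 f (Sum.inl ν) else 0) :=
    hG.prod_symm
  -- left side: the `(s′, s)` iterated sum
  have hL : (∑' s' : Site (d + 1), (if s' ν % (Lc : ℤ) = (Lc : ℤ) - 1 then comp X T t s' g (Sum.inl ν) else 0)) =
      ∑' s' : Site (d + 1), ∑' s : Site (d + 1), ∑ f : Fib d, X t s g f * (if s' ν % (Lc : ℤ) = (Lc : ℤ) - 1 then T s s' f (Sum.inl ν) else 0) := by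
    refine tsum_congr fun s' => ?_
    split_ifs with h
    · rfl
    · symm
      refine (tsum_congr fun s => ?_).trans tsum_zero
      exact Finset.sum_eq_zero fun f _ => by rw [mul_zero]
  -- right side: the `(s, s′)` iterated sum
  have hR : (∑' s : Site (d + 1), ∑ f : Fib d, X t s g f * ∑' s' : Site (d + 1), (if s' ν % (Lc : ℤ) = (Lc : ℤ) - 1 then T s s' f (Sum.inl ν) else 0)) =
      ∑' s : Site (d + 1), ∑' s' : Site (d + 1), ∑ f : Fib d, X t s g f * (if s' ν % (Lc : ℤ) = (Lc : ℤ) - 1 then T s s' f (Sum.inl ν) else 0) := by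
    refine tsum_congr fun s => ?_
    rw [Summable.tsum_finsetSum (fun f _ => (summable_faceSource Lc hT hmT ν s f).mul_left (X t s g f))]
    refine Finset.sum_congr rfl fun f _ => ?_
    rw [tsum_mul_left]
  rw [hL, hR]
  calc (∑' s' : Site (d + 1), ∑' s : Site (d + 1), ∑ f : Fib d, X t s g f * (if s' ν % (Lc : ℤ) = (Lc : ℤ) - 1 then T s s' f (Sum.inl ν) else 0))
      = ∑' q : Site (d + 1) × Site (d + 1), ∑ f : Fib d, X t q.2 g f * (if q.1 ν % (Lc : ℤ) = (Lc : ℤ) - 1 then T q.2 q.1 f (Sum.inl ν) else 0) := hG'.tsum_prod.symm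
    _ = ∑' q : Site (d + 1) × Site (d + 1), ∑ f : Fib d, X t q.1 g f * (if q.2 ν % (Lc : ℤ) = (Lc : ℤ) - 1 then T q.1 q.2 f (Sum.inl ν) else 0) :=
        (Equiv.prodComm (Site (d + 1)) (Site (d + 1))).tsum_eq
          (fun q : Site (d + 1) × Site (d + 1) => ∑ f : Fib d, X t q.1 g f * (if q.2 ν % (Lc : ℤ) = (Lc : ℤ) - 1 then T q.1 q.2 f (Sum.inl ν) else 0))
    _ = _ := hG.tsum_prod

/-- [folklore] **THE COLUMN CHARGE OF `𝒦_μ` AGAINST `inr ν` IS `−c₀σ·X̃·𝒥′_{μν}`** (in-block root, `1 ≤ Lc`, every `j`, `S` `LocStencil`, every row `(t, g)`):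
`−Σ'_{s′}Σ_b (X̃∘𝒮_μ)(t,s′)(g,b)·chg_ν(b,s′) = −(c₀σ · Σ'_s Σ_f X̃(t,s)(g,f) · Σ'_{s′}[s′_ν]·𝒮_μ(s,s′)(f, inl ν))`, `c₀ = Lc s_m s_f`, `σ = (Lc^{j+1})^{−(d+2)}`. -/
theorem respCharge_eq (hLc : 1 ≤ Lc) (hr : r ∈ box (d + 1) Lc) (sf sm : ℝ) (j : ℕ) (hS : LocStencil S Cs δs) (hδs : 0 < δs)
    (μ ν : Fin (d + 1)) (t : Site (d + 1)) (g : Fib d) :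
    (-(∑' s' : Site (d + 1), ∑ b : Fib d,
        comp (unitK sf sm (coDressKBmAt (toSite r) Lc (KInvStep (d := d) Lc j)))
          (fun x z a b => ((Lc : ℝ) * (sm * sf)) * ((((Lc ^ (j + 1) : ℕ) : ℝ)) ^ (d + 1 + 1))⁻¹ *
            ∑' t : Site (d + 1), (if t μ % (Lc : ℤ) = (Lc : ℤ) - 1 then S μ t x z a b else 0)) t s' g b *
          Sum.elim (fun a : Fin (d + 1) => if s' a % (Lc : ℤ) = (Lc : ℤ) - 1 then ((Lc : ℝ) * (sm * sf)) *
            (if a = ν then ((((Lc ^ (j + 1) : ℕ) : ℝ)) ^ (d + 1 + 1))⁻¹ else 0) else 0) (fun _ => (0 : ℝ)) b)) =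
      -((((Lc : ℝ) * (sm * sf)) * ((((Lc ^ (j + 1) : ℕ) : ℝ)) ^ (d + 1 + 1))⁻¹) *
        ∑' s : Site (d + 1), ∑ f : Fib d, unitK sf sm (coDressKBmAt (toSite r) Lc (KInvStep (d := d) Lc j)) t s g f *
          ∑' s' : Site (d + 1), (if s' ν % (Lc : ℤ) = (Lc : ℤ) - 1 then
            (((Lc : ℝ) * (sm * sf)) * ((((Lc ^ (j + 1) : ℕ) : ℝ)) ^ (d + 1 + 1))⁻¹ *
              ∑' t' : Site (d + 1), (if t' μ % (Lc : ℤ) = (Lc : ℤ) - 1 then S μ t' s s' f (Sum.inl ν) else 0)) else 0)) := by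
  obtain ⟨δ, C, hδ, hC, hXd⟩ := decays_coDressKBmAt hLc hr (decays_KInvStep (d := d) (Lc := Lc) j)
  have hXu := decays_unitK (sf := sf) (sm := sm) hXd
  have hG := Summit.QuantumFields.BalabanUV.Beta.GAN24.RespInnerBondKernel.decays_gaugeStencil (Lc := Lc) hS hδs sf sm j μ
  simp_rw [sum_mul_faceCharge]
  rw [show (∑' s' : Site (d + 1), comp (unitK sf sm (coDressKBmAt (toSite r) Lc (KInvStep (d := d) Lc j)))
          (fun x z a b => ((Lc : ℝ) * (sm * sf)) * ((((Lc ^ (j + 1) : ℕ) : ℝ)) ^ (d + 1 + 1))⁻¹ *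
            ∑' t : Site (d + 1), (if t μ % (Lc : ℤ) = (Lc : ℤ) - 1 then S μ t x z a b else 0)) t s' g (Sum.inl ν) *
          (if s' ν % (Lc : ℤ) = (Lc : ℤ) - 1 then ((Lc : ℝ) * (sm * sf)) * ((((Lc ^ (j + 1) : ℕ) : ℝ)) ^ (d + 1 + 1))⁻¹ else 0)) =
      (((Lc : ℝ) * (sm * sf)) * ((((Lc ^ (j + 1) : ℕ) : ℝ)) ^ (d + 1 + 1))⁻¹) *
        ∑' s' : Site (d + 1), (if s' ν % (Lc : ℤ) = (Lc : ℤ) - 1 then comp (unitK sf sm (coDressKBmAt (toSite r) Lc (KInvStep (d := d) Lc j)))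
          (fun x z a b => ((Lc : ℝ) * (sm * sf)) * ((((Lc ^ (j + 1) : ℕ) : ℝ)) ^ (d + 1 + 1))⁻¹ *
            ∑' t : Site (d + 1), (if t μ % (Lc : ℤ) = (Lc : ℤ) - 1 then S μ t x z a b else 0)) t s' g (Sum.inl ν) else 0) by
    rw [← tsum_mul_left]
    refine tsum_congr fun s' => ?_
    split_ifs <;> ring]
  rw [tsum_comp_faceCharge_eq (Lc := Lc) hXu hδ hG (half_pos hδs) ν t g]

end Generic

/-! ## §2 Level 0: the symmetrised face source of `S♮_0` — zero on field legs, block-periodic, coarsely supported on multiplier legs -/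

section LevelZero

/-- [folklore] **ON FIELD LEGS THE SYMMETRISED FACE SOURCE OF `S♮_0` VANISHES** (35 `tsum_faceface_S0_add_swap`, the constant `c₀σ` pulled through). -/
theorem faceSource_S0_add_swap_inl (ρ : Fin (d + 1) → ℤ) (sf sm cE cVH cΛ K : ℝ) (μ ν b : Fin (d + 1)) (s : Site (d + 1)) :
    (∑' s' : Site (d + 1), (if s' ν % (Lc : ℤ) = (Lc : ℤ) - 1 then
        K * ∑' t' : Site (d + 1), (if t' μ % (Lc : ℤ) = (Lc : ℤ) - 1 then unitS sf sm (SpureRecAt d Lc ρ cE cVH cΛ 0) μ t' s s' (Sum.inl b) (Sum.inl ν) else 0) else 0)) +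
      ∑' s' : Site (d + 1), (if s' μ % (Lc : ℤ) = (Lc : ℤ) - 1 then
        K * ∑' t' : Site (d + 1), (if t' ν % (Lc : ℤ) = (Lc : ℤ) - 1 then unitS sf sm (SpureRecAt d Lc ρ cE cVH cΛ 0) ν t' s s' (Sum.inl b) (Sum.inl μ) else 0) else 0) = 0 := by
  have e : ∀ (κ τ : Fin (d + 1)),
      (∑' s' : Site (d + 1), (if s' τ % (Lc : ℤ) = (Lc : ℤ) - 1 then
        K * ∑' t' : Site (d + 1), (if t' κ % (Lc : ℤ) = (Lc : ℤ) - 1 then unitS sf sm (SpureRecAt d Lc ρ cE cVH cΛ 0) κ t' s s' (Sum.inl b) (Sum.inl τ) else 0) else 0)) =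
      K * ∑' s' : Site (d + 1), (if s' τ % (Lc : ℤ) = (Lc : ℤ) - 1 then
        ∑' t' : Site (d + 1), (if t' κ % (Lc : ℤ) = (Lc : ℤ) - 1 then unitS sf sm (SpureRecAt d Lc ρ cE cVH cΛ 0) κ t' s s' (Sum.inl b) (Sum.inl τ) else 0) else 0) := by
    intro κ τ
    rw [← tsum_mul_left]
    refine tsum_congr fun s' => ?_
    split_ifs <;> ring
  rw [e, e, ← mul_add, tsum_faceface_S0_add_swap ρ sf sm cE cVH cΛ μ ν b s, mul_zero]

omit [NeZero Lc] in
/-- [folklore] **THE FACE SOURCE OF A BLOCK-COVARIANT `S` IS `Lc`-BLOCK-PERIODIC IN ITS FREE LEG** (35 `tsum_faceface_block_periodic`, constant pulled through). -/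
theorem faceSource_block_periodic (hScov : ∀ (κ : Fin (d + 1)) (u t : Site (d + 1)), S κ (u + (Lc : ℤ) • t) = shiftK (-((Lc : ℤ) • t)) (S κ u))
    (K : ℝ) (μ ν : Fin (d + 1)) (s v : Site (d + 1)) (f : Fib d) :
    (∑' s' : Site (d + 1), (if s' ν % (Lc : ℤ) = (Lc : ℤ) - 1 then
        K * ∑' t' : Site (d + 1), (if t' μ % (Lc : ℤ) = (Lc : ℤ) - 1 then S μ t' (s + (Lc : ℤ) • v) s' f (Sum.inl ν) else 0) else 0)) =
      ∑' s' : Site (d + 1), (if s' ν % (Lc : ℤ) = (Lc : ℤ) - 1 then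
        K * ∑' t' : Site (d + 1), (if t' μ % (Lc : ℤ) = (Lc : ℤ) - 1 then S μ t' s s' f (Sum.inl ν) else 0) else 0) := by
  have e : ∀ s₀ : Site (d + 1), (∑' s' : Site (d + 1), (if s' ν % (Lc : ℤ) = (Lc : ℤ) - 1 then
        K * ∑' t' : Site (d + 1), (if t' μ % (Lc : ℤ) = (Lc : ℤ) - 1 then S μ t' s₀ s' f (Sum.inl ν) else 0) else 0)) =
      K * ∑' s' : Site (d + 1), (if s' ν % (Lc : ℤ) = (Lc : ℤ) - 1 then
        ∑' t' : Site (d + 1), (if t' μ % (Lc : ℤ) = (Lc : ℤ) - 1 then S μ t' s₀ s' f (Sum.inl ν) else 0) else 0) := by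
    intro s₀
    rw [← tsum_mul_left]
    refine tsum_congr fun s' => ?_
    split_ifs <;> ring
  rw [e, e, tsum_faceface_block_periodic (N := Lc) hScov μ ν s v f (Sum.inl ν)]

/-- [folklore] **THE MULTIPLIER FIRST LEGS OF `S♮_0` SIT ON THE COARSE LATTICE**: `unitS s_f s_m (SpureRecAt … 0) κ t z w (inr m) b = 0` for `off Lc z ≠ 0` (`wilsonA` has no multiplier legs;
28 `vhS_inr_fst_eq_zero`). -/
theorem SpureRecAt_zero_unitS_inr_fst_off (sf sm cE cVH cΛ : ℝ) (κ : Fin (d + 1)) (t z w : Site (d + 1)) (m : Fin (d + 1)) (b : Fib d) (hz : off Lc z ≠ 0) :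
    unitS sf sm (SpureRecAt d Lc (toSite r) cE cVH cΛ 0) κ t z w (Sum.inr m) b = 0 := by
  rw [unitS_apply, SpureRecAt_zero_level]
  have h1 : (cVH • AveragingHessianKernelsRooted.vhSAt (toSite r) d Lc rfl κ t) z w (Sum.inr m) b = 0 := vhS_inr_fst_eq_zero (r := r) cVH κ t z w m b hz
  have h2 : wilsonA d κ t z w (Sum.inr m) b = 0 := by rcases b with b | b <;> rfl
  simp only [Pi.add_apply, Pi.smul_apply, smul_eq_mul, h2, mul_zero, zero_add]
  rw [show cVH * AveragingHessianKernelsRooted.vhSAt (toSite r) d Lc rfl κ t z w (Sum.inr m) b = 0 by simpa only [Pi.smul_apply, smul_eq_mul] using h1]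
  ring

/-- [folklore] **… HENCE THE FACE SOURCE OF `S♮_0` VANISHES ON MULTIPLIER LEGS OFF THE COARSE LATTICE.** -/
theorem faceSource_S0_inr_off (sf sm cE cVH cΛ K : ℝ) (μ ν ρ' : Fin (d + 1)) {s : Site (d + 1)} (hs : off Lc s ≠ 0) :
    (∑' s' : Site (d + 1), (if s' ν % (Lc : ℤ) = (Lc : ℤ) - 1 then
        K * ∑' t' : Site (d + 1), (if t' μ % (Lc : ℤ) = (Lc : ℤ) - 1 then unitS sf sm (SpureRecAt d Lc (toSite r) cE cVH cΛ 0) μ t' s s' (Sum.inr ρ') (Sum.inl ν) else 0) else 0)) = 0 := by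
  refine (tsum_congr fun s' => ?_).trans tsum_zero
  split_ifs with h
  · rw [show (∑' t' : Site (d + 1), (if t' μ % (Lc : ℤ) = (Lc : ℤ) - 1 then unitS sf sm (SpureRecAt d Lc (toSite r) cE cVH cΛ 0) μ t' s s' (Sum.inr ρ') (Sum.inl ν) else 0)) = 0 from
      (tsum_congr fun t' => by
        split_ifs
        · exact SpureRecAt_zero_unitS_inr_fst_off sf sm cE cVH cΛ μ t' s s' ρ' (Sum.inl ν) hs
        · rfl).trans tsum_zero, mul_zero]
  · rfl

end LevelZero

/-! ## §3 The symmetrised charge -/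

section Sym

/-- [folklore] **THE `(μ ↔ ν)`-SYMMETRISED COLUMN CHARGES OF THE GAUGE-DIFFERENTIATED INVERSE AT LEVEL 0** (in-block root, `1 ≤ Lc`, all units and colour constants, every row `(t, g)`):
with `S♮_0 = unitS s_f s_m (SpureRecAt … 0)`, `c₀ = Lc s_m s_f`, `σ = (Lc^{1})^{−(d+2)}`, `𝒥′_{μν}(s, f) = Σ'_{s′}[s′_ν]·c₀σ·Σ'_{t′}[t′_μ]·S♮_0 μ t′ s s′ f (inl ν)`,
`chg^{𝒦_μ}_ν(g,t) + chg^{𝒦_ν}_μ(g,t) = −c₀σ · Σ_{ρ′} chg_{ρ′}(g, t) · (𝒥′_{μν} + 𝒥′_{νμ})(0, inr ρ′)`, `chg_{ρ′}(g,t) = Sum.elim (κ ↦ [t_κ]·c₀·[κ = ρ′]σ) 0 g` — the field-leg source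
cancels (§2), the multiplier-leg source is a block constant against the coarsely supported `inr` columns of `X̃♮_0` (25 `tsum_col_mul_profile` with 4 `hasSum_dressedStep_col`). -/
theorem respCharge_add_swap_eq (hLc : 1 ≤ Lc) (hr : r ∈ box (d + 1) Lc) (sf sm cE cVH cΛ : ℝ) (μ ν : Fin (d + 1)) (t : Site (d + 1)) (g : Fib d) :
    (-(∑' s' : Site (d + 1), ∑ b : Fib d,
        comp (unitK sf sm (coDressKBmAt (toSite r) Lc (KInvStep (d := d) Lc 0)))
          (fun x z a b => ((Lc : ℝ) * (sm * sf)) * ((((Lc ^ (0 + 1) : ℕ) : ℝ)) ^ (d + 1 + 1))⁻¹ *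
            ∑' t : Site (d + 1), (if t μ % (Lc : ℤ) = (Lc : ℤ) - 1 then unitS sf sm (SpureRecAt d Lc (toSite r) cE cVH cΛ 0) μ t x z a b else 0)) t s' g b *
          Sum.elim (fun a : Fin (d + 1) => if s' a % (Lc : ℤ) = (Lc : ℤ) - 1 then ((Lc : ℝ) * (sm * sf)) *
            (if a = ν then ((((Lc ^ (0 + 1) : ℕ) : ℝ)) ^ (d + 1 + 1))⁻¹ else 0) else 0) (fun _ => (0 : ℝ)) b)) +
      -(∑' s' : Site (d + 1), ∑ b : Fib d,
        comp (unitK sf sm (coDressKBmAt (toSite r) Lc (KInvStep (d := d) Lc 0)))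
          (fun x z a b => ((Lc : ℝ) * (sm * sf)) * ((((Lc ^ (0 + 1) : ℕ) : ℝ)) ^ (d + 1 + 1))⁻¹ *
            ∑' t : Site (d + 1), (if t ν % (Lc : ℤ) = (Lc : ℤ) - 1 then unitS sf sm (SpureRecAt d Lc (toSite r) cE cVH cΛ 0) ν t x z a b else 0)) t s' g b *
          Sum.elim (fun a : Fin (d + 1) => if s' a % (Lc : ℤ) = (Lc : ℤ) - 1 then ((Lc : ℝ) * (sm * sf)) *
            (if a = μ then ((((Lc ^ (0 + 1) : ℕ) : ℝ)) ^ (d + 1 + 1))⁻¹ else 0) else 0) (fun _ => (0 : ℝ)) b) =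
      -((((Lc : ℝ) * (sm * sf)) * ((((Lc ^ (0 + 1) : ℕ) : ℝ)) ^ (d + 1 + 1))⁻¹) *
        ∑ ρ' : Fin (d + 1), Sum.elim (fun κ : Fin (d + 1) => if t κ % (Lc : ℤ) = (Lc : ℤ) - 1 then ((Lc : ℝ) * (sm * sf)) *
            (if κ = ρ' then ((((Lc ^ (0 + 1) : ℕ) : ℝ)) ^ (d + 1 + 1))⁻¹ else 0) else 0) (fun _ => (0 : ℝ)) g *
          ((∑' s' : Site (d + 1), (if s' ν % (Lc : ℤ) = (Lc : ℤ) - 1 then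
              (((Lc : ℝ) * (sm * sf)) * ((((Lc ^ (0 + 1) : ℕ) : ℝ)) ^ (d + 1 + 1))⁻¹ *
                ∑' t' : Site (d + 1), (if t' μ % (Lc : ℤ) = (Lc : ℤ) - 1 then unitS sf sm (SpureRecAt d Lc (toSite r) cE cVH cΛ 0) μ t' 0 s' (Sum.inr ρ') (Sum.inl ν) else 0)) else 0)) +
            ∑' s' : Site (d + 1), (if s' μ % (Lc : ℤ) = (Lc : ℤ) - 1 then
              (((Lc : ℝ) * (sm * sf)) * ((((Lc ^ (0 + 1) : ℕ) : ℝ)) ^ (d + 1 + 1))⁻¹ *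
                ∑' t' : Site (d + 1), (if t' ν % (Lc : ℤ) = (Lc : ℤ) - 1 then unitS sf sm (SpureRecAt d Lc (toSite r) cE cVH cΛ 0) ν t' 0 s' (Sum.inr ρ') (Sum.inl μ) else 0)) else 0))) := by
  classical
  obtain ⟨Cs₀, δs₀, hδs₀, hS₀⟩ := Summit.QuantumFields.BalabanUV.Beta.SpineRooted.locStencil_SpureRecAt (d := d) (Lc := Lc) hLc hr cE cVH cΛ 0
  have hS := Summit.QuantumFields.BalabanUV.Beta.HessKerDressedUnits.locStencil_unitS (sf := sf) (sm := sm) hS₀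
  rw [respCharge_eq hLc hr sf sm 0 hS hδs₀ μ ν t g, respCharge_eq hLc hr sf sm 0 hS hδs₀ ν μ t g, ← neg_add, ← mul_add]
  congr 2
  -- abbreviations: the dressed kernel and the two face sources
  obtain ⟨δ, C, hδ, hC, hXd⟩ := decays_coDressKBmAt hLc hr (decays_KInvStep (d := d) (Lc := Lc) 0)
  have hXu := decays_unitK (sf := sf) (sm := sm) hXd
  have hCX : 0 ≤ max |sf| |sm| * C * max |sf| |sm| := by positivity
  have hGμ := Summit.QuantumFields.BalabanUV.Beta.GAN24.RespInnerBondKernel.decays_gaugeStencil (Lc := Lc) hS hδs₀ sf sm 0 μ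
  have hGν := Summit.QuantumFields.BalabanUV.Beta.GAN24.RespInnerBondKernel.decays_gaugeStencil (Lc := Lc) hS hδs₀ sf sm 0 ν
  -- summability of the two `s`-families (decaying kernel × bounded source)
  have hsum : ∀ (κ τ : Fin (d + 1)), Summable fun s : Site (d + 1) => ∑ f : Fib d, unitK sf sm (coDressKBmAt (toSite r) Lc (KInvStep (d := d) Lc 0)) t s g f *
      ∑' s' : Site (d + 1), (if s' τ % (Lc : ℤ) = (Lc : ℤ) - 1 then
        (((Lc : ℝ) * (sm * sf)) * ((((Lc ^ (0 + 1) : ℕ) : ℝ)) ^ (d + 1 + 1))⁻¹ *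
          ∑' t' : Site (d + 1), (if t' κ % (Lc : ℤ) = (Lc : ℤ) - 1 then unitS sf sm (SpureRecAt d Lc (toSite r) cE cVH cΛ 0) κ t' s s' f (Sum.inl τ) else 0)) else 0) := by
    intro κ τ
    obtain ⟨CG, hGκ⟩ : ∃ CG : ℝ, Decays (fun x z a b => ((Lc : ℝ) * (sm * sf)) * ((((Lc ^ (0 + 1) : ℕ) : ℝ)) ^ (d + 1 + 1))⁻¹ *
        ∑' t : Site (d + 1), (if t κ % (Lc : ℤ) = (Lc : ℤ) - 1 then unitS sf sm (SpureRecAt d Lc (toSite r) cE cVH cΛ 0) κ t x z a b else 0)) CG (δs₀ / 2) :=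
      ⟨_, Summit.QuantumFields.BalabanUV.Beta.GAN24.RespInnerBondKernel.decays_gaugeStencil (Lc := Lc) hS hδs₀ sf sm 0 κ⟩
    have hCG : 0 ≤ CG := hGκ.nonneg (Sum.inl 0)
    refine summable_sum fun f _ => ?_
    refine Summable.of_norm_bounded (((summable_exp_shift hδ t).mul_left (max |sf| |sm| * C * max |sf| |sm|)).mul_right (CG * Zl (d + 1) (δs₀ / 2))) (fun s => ?_)
    rw [Real.norm_eq_abs, abs_mul]
    exact mul_le_mul (hXu t s g f) (abs_faceSource_le Lc hGκ (half_pos hδs₀) τ s f) (abs_nonneg _) (by positivity)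
  rw [← (hsum μ ν).tsum_add (hsum ν μ)]
  simp_rw [← Finset.sum_add_distrib, ← mul_add]
  -- split the fibre sum into field legs (zero) and multiplier legs (block constants on the coarse lattice)
  have hsplit : ∀ s : Site (d + 1), (∑ f : Fib d, unitK sf sm (coDressKBmAt (toSite r) Lc (KInvStep (d := d) Lc 0)) t s g f *
      ((∑' s' : Site (d + 1), (if s' ν % (Lc : ℤ) = (Lc : ℤ) - 1 then
          (((Lc : ℝ) * (sm * sf)) * ((((Lc ^ (0 + 1) : ℕ) : ℝ)) ^ (d + 1 + 1))⁻¹ *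
            ∑' t' : Site (d + 1), (if t' μ % (Lc : ℤ) = (Lc : ℤ) - 1 then unitS sf sm (SpureRecAt d Lc (toSite r) cE cVH cΛ 0) μ t' s s' f (Sum.inl ν) else 0)) else 0)) +
        ∑' s' : Site (d + 1), (if s' μ % (Lc : ℤ) = (Lc : ℤ) - 1 then
          (((Lc : ℝ) * (sm * sf)) * ((((Lc ^ (0 + 1) : ℕ) : ℝ)) ^ (d + 1 + 1))⁻¹ *
            ∑' t' : Site (d + 1), (if t' ν % (Lc : ℤ) = (Lc : ℤ) - 1 then unitS sf sm (SpureRecAt d Lc (toSite r) cE cVH cΛ 0) ν t' s s' f (Sum.inl μ) else 0)) else 0))) =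
      ∑ ρ' : Fin (d + 1), unitK sf sm (coDressKBmAt (toSite r) Lc (KInvStep (d := d) Lc 0)) t s g (Sum.inr ρ') *
        ((∑' s' : Site (d + 1), (if s' ν % (Lc : ℤ) = (Lc : ℤ) - 1 then
            (((Lc : ℝ) * (sm * sf)) * ((((Lc ^ (0 + 1) : ℕ) : ℝ)) ^ (d + 1 + 1))⁻¹ *
              ∑' t' : Site (d + 1), (if t' μ % (Lc : ℤ) = (Lc : ℤ) - 1 then unitS sf sm (SpureRecAt d Lc (toSite r) cE cVH cΛ 0) μ t' s s' (Sum.inr ρ') (Sum.inl ν) else 0)) else 0)) +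
          ∑' s' : Site (d + 1), (if s' μ % (Lc : ℤ) = (Lc : ℤ) - 1 then
            (((Lc : ℝ) * (sm * sf)) * ((((Lc ^ (0 + 1) : ℕ) : ℝ)) ^ (d + 1 + 1))⁻¹ *
              ∑' t' : Site (d + 1), (if t' ν % (Lc : ℤ) = (Lc : ℤ) - 1 then unitS sf sm (SpureRecAt d Lc (toSite r) cE cVH cΛ 0) ν t' s s' (Sum.inr ρ') (Sum.inl μ) else 0)) else 0)) := by
    intro s
    rw [Fintype.sum_sum_type]
    have hl : ∑ b : Fin (d + 1), unitK sf sm (coDressKBmAt (toSite r) Lc (KInvStep (d := d) Lc 0)) t s g (Sum.inl b) *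
        ((∑' s' : Site (d + 1), (if s' ν % (Lc : ℤ) = (Lc : ℤ) - 1 then
            (((Lc : ℝ) * (sm * sf)) * ((((Lc ^ (0 + 1) : ℕ) : ℝ)) ^ (d + 1 + 1))⁻¹ *
              ∑' t' : Site (d + 1), (if t' μ % (Lc : ℤ) = (Lc : ℤ) - 1 then unitS sf sm (SpureRecAt d Lc (toSite r) cE cVH cΛ 0) μ t' s s' (Sum.inl b) (Sum.inl ν) else 0)) else 0)) +
          ∑' s' : Site (d + 1), (if s' μ % (Lc : ℤ) = (Lc : ℤ) - 1 then
            (((Lc : ℝ) * (sm * sf)) * ((((Lc ^ (0 + 1) : ℕ) : ℝ)) ^ (d + 1 + 1))⁻¹ *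
              ∑' t' : Site (d + 1), (if t' ν % (Lc : ℤ) = (Lc : ℤ) - 1 then unitS sf sm (SpureRecAt d Lc (toSite r) cE cVH cΛ 0) ν t' s s' (Sum.inl b) (Sum.inl μ) else 0)) else 0)) = 0 :=
      Finset.sum_eq_zero fun b _ => by rw [faceSource_S0_add_swap_inl (toSite r) sf sm cE cVH cΛ _ μ ν b s, mul_zero]
    rw [hl, zero_add]
  simp_rw [hsplit]
  rw [Summable.tsum_finsetSum (fun ρ' _ => ?_)]
  · refine Finset.sum_congr rfl fun ρ' _ => ?_
    have hper : ∀ z v : Site (d + 1),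
        ((∑' s' : Site (d + 1), (if s' ν % (Lc : ℤ) = (Lc : ℤ) - 1 then
            (((Lc : ℝ) * (sm * sf)) * ((((Lc ^ (0 + 1) : ℕ) : ℝ)) ^ (d + 1 + 1))⁻¹ *
              ∑' t' : Site (d + 1), (if t' μ % (Lc : ℤ) = (Lc : ℤ) - 1 then unitS sf sm (SpureRecAt d Lc (toSite r) cE cVH cΛ 0) μ t' (z + (Lc : ℤ) • v) s' (Sum.inr ρ') (Sum.inl ν) else 0)) else 0)) +
          ∑' s' : Site (d + 1), (if s' μ % (Lc : ℤ) = (Lc : ℤ) - 1 then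
            (((Lc : ℝ) * (sm * sf)) * ((((Lc ^ (0 + 1) : ℕ) : ℝ)) ^ (d + 1 + 1))⁻¹ *
              ∑' t' : Site (d + 1), (if t' ν % (Lc : ℤ) = (Lc : ℤ) - 1 then unitS sf sm (SpureRecAt d Lc (toSite r) cE cVH cΛ 0) ν t' (z + (Lc : ℤ) • v) s' (Sum.inr ρ') (Sum.inl μ) else 0)) else 0)) =
        ((∑' s' : Site (d + 1), (if s' ν % (Lc : ℤ) = (Lc : ℤ) - 1 then
            (((Lc : ℝ) * (sm * sf)) * ((((Lc ^ (0 + 1) : ℕ) : ℝ)) ^ (d + 1 + 1))⁻¹ *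
              ∑' t' : Site (d + 1), (if t' μ % (Lc : ℤ) = (Lc : ℤ) - 1 then unitS sf sm (SpureRecAt d Lc (toSite r) cE cVH cΛ 0) μ t' z s' (Sum.inr ρ') (Sum.inl ν) else 0)) else 0)) +
          ∑' s' : Site (d + 1), (if s' μ % (Lc : ℤ) = (Lc : ℤ) - 1 then
            (((Lc : ℝ) * (sm * sf)) * ((((Lc ^ (0 + 1) : ℕ) : ℝ)) ^ (d + 1 + 1))⁻¹ *
              ∑' t' : Site (d + 1), (if t' ν % (Lc : ℤ) = (Lc : ℤ) - 1 then unitS sf sm (SpureRecAt d Lc (toSite r) cE cVH cΛ 0) ν t' z s' (Sum.inr ρ') (Sum.inl μ) else 0)) else 0)) := by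
      intro z v
      have hScov := Summit.QuantumFields.BalabanUV.Beta.GAN24.VHWordsZeroBorder.unitS_translate_block sf sm
        (Summit.QuantumFields.BalabanUV.Beta.SpineRooted.SpureRecAt_translate (d := d) (Lc := Lc) (toSite r) hLc cE cVH cΛ 0)
      rw [faceSource_block_periodic hScov _ μ ν z v (Sum.inr ρ'), faceSource_block_periodic hScov _ ν μ z v (Sum.inr ρ')]
    have hoff : ∀ z : Site (d + 1), off Lc z ≠ 0 →
        ((∑' s' : Site (d + 1), (if s' ν % (Lc : ℤ) = (Lc : ℤ) - 1 then
            (((Lc : ℝ) * (sm * sf)) * ((((Lc ^ (0 + 1) : ℕ) : ℝ)) ^ (d + 1 + 1))⁻¹ *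
              ∑' t' : Site (d + 1), (if t' μ % (Lc : ℤ) = (Lc : ℤ) - 1 then unitS sf sm (SpureRecAt d Lc (toSite r) cE cVH cΛ 0) μ t' z s' (Sum.inr ρ') (Sum.inl ν) else 0)) else 0)) +
          ∑' s' : Site (d + 1), (if s' μ % (Lc : ℤ) = (Lc : ℤ) - 1 then
            (((Lc : ℝ) * (sm * sf)) * ((((Lc ^ (0 + 1) : ℕ) : ℝ)) ^ (d + 1 + 1))⁻¹ *
              ∑' t' : Site (d + 1), (if t' ν % (Lc : ℤ) = (Lc : ℤ) - 1 then unitS sf sm (SpureRecAt d Lc (toSite r) cE cVH cΛ 0) ν t' z s' (Sum.inr ρ') (Sum.inl μ) else 0)) else 0)) = 0 := by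
      intro z hz
      rw [faceSource_S0_inr_off (r := r) sf sm cE cVH cΛ _ μ ν ρ' hz, faceSource_S0_inr_off (r := r) sf sm cE cVH cΛ _ ν μ ρ' hz, add_zero]
    exact tsum_col_mul_profile (N := Lc) (hasSum_dressedStep_col hLc hr sf sm 0 ρ' g t) hper hoff
  · obtain ⟨CG, hGμ', hGν'⟩ : ∃ CG : ℝ,
        Decays (fun x z a b => ((Lc : ℝ) * (sm * sf)) * ((((Lc ^ (0 + 1) : ℕ) : ℝ)) ^ (d + 1 + 1))⁻¹ *
          ∑' t : Site (d + 1), (if t μ % (Lc : ℤ) = (Lc : ℤ) - 1 then unitS sf sm (SpureRecAt d Lc (toSite r) cE cVH cΛ 0) μ t x z a b else 0)) CG (δs₀ / 2) ∧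
        Decays (fun x z a b => ((Lc : ℝ) * (sm * sf)) * ((((Lc ^ (0 + 1) : ℕ) : ℝ)) ^ (d + 1 + 1))⁻¹ *
          ∑' t : Site (d + 1), (if t ν % (Lc : ℤ) = (Lc : ℤ) - 1 then unitS sf sm (SpureRecAt d Lc (toSite r) cE cVH cΛ 0) ν t x z a b else 0)) CG (δs₀ / 2) :=
      ⟨_, hGμ, hGν⟩
    have hCG : 0 ≤ CG := hGμ'.nonneg (Sum.inl 0)
    refine Summable.of_norm_bounded (((summable_exp_shift hδ t).mul_left (max |sf| |sm| * C * max |sf| |sm|)).mul_right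
      (CG * Zl (d + 1) (δs₀ / 2) + CG * Zl (d + 1) (δs₀ / 2))) (fun s => ?_)
    rw [Real.norm_eq_abs, abs_mul]
    refine mul_le_mul (hXu t s g (Sum.inr ρ')) ((abs_add_le _ _).trans (add_le_add
      (abs_faceSource_le Lc hGμ' (half_pos hδs₀) ν s (Sum.inr ρ')) (abs_faceSource_le Lc hGν' (half_pos hδs₀) μ s (Sum.inr ρ')))) (abs_nonneg _) (by positivity)

end Sym

end Summit.QuantumFields.BalabanUV.Beta.GAN24.RespChargeSym

end
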